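import Literature.NumberTheory.EllipticCurves.Wuthrich2014.ThreeAdicImageOrdinaryProofs
import Literature.NumberTheory.EllipticCurves.Rank1Residual.Predicates
import HarnessLib

/-!
# Multiplicative `p` (and class X11 at `p = 3`) without the Lemma-20 binder: the `p`-adic tower on
# `Mult W p ∧ Surj W p` is a theorem

HONEST FRAMING (cell `b2b-bsdres`, home `run/shared/lean/b2b/bsd-rank1-residual/`): the cell deletes
COMBINATION-SHAPED residual classes of the rank-`≤ 1` BSD formula from PUBLISHED theorems only and
types the construction-shaped remainder; announced results are OPEN hypotheses; this is not
"finishing BSD".  `Proofs` file (theorems only: no definition, no named fact, debt 0), unit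
`b2b-bsdres-lit-kato` gen 7 (off-peak Kato-2004 typer); companion of `X10OrdinaryTowerProofs.lean`.

Every `p = 3` consumer of Kato's Euler system at a MULTIPLICATIVE `3` (class X11 at `3`:
`X11a/MainConjectureThree*.lean`, `Typed/PAdicCertificateMultiplicativeThree.lean`,
`Typed/PAdicCertificateSurjectiveThree.lean`; the multiplicative twists of the `AdditivePotMult` cells;
the multiplicative rows of `Partition/Corners*`) carried the named fact
`Wuthrich2014.lemma20_surjective_threeAdic_of_semistable` (registry A9) as a binder, used only through
`h20 W (Or.inr <multiplicative at 3>) hsurj`.  On that locus the lemma is now the tree THEOREM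
`WeierstrassCurve.forall_hasSurjectiveModNGaloisRep_pow_of_multiplicative_of_surj`
(`Wuthrich2014/ThreeAdicImageOrdinaryProofs.lean`, Appendix: the Tate line of the Tate form of
invariant `j(E)` at every level `p^m` + `χ_p(I_p) = ℤ_pˣ` + `det ρ = χ_p` + the first-order witness
`σ₄σ₋σ₄σ₋`).  This file records the binder-free forms in the cell's predicate vocabulary:

* `surjective_pow_of_mult_of_surj` — `Mult W p → Surj W p → ∀ n, surj(p^n)` (`p` odd);
* `surjective_pow_three_of_mult_of_tateLine` — the statement of
  `Typed.surjective_pow_three_of_mult` WITHOUT its first argument `h20` (drop-in replacement);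
* `X11.towerSurj_of_surj` — `ClassX11 W 3 → Surj W 3 → ∀ n, surj(3^n)`;
  `X11.imageContainsSL2_of_surj` — Kato's (12.5.2) on X11 ∩ surj(3) at `p = 3`;
* `surjective_pow_three_of_semistable_of_not_supersingular_of_surj` — Lemma 20 off the
  good-supersingular locus in predicate form: `(GoodOrd W 3 ∨ Mult W 3) → Surj W 3 → tower`.

Nothing is booked and no label changes (X11 ∧ `p = 3` stays as classified); what changes is that
the multiplicative-`3` routes no longer carry the A9 binder.

## References

* [Wuthrich2014] C. Wuthrich, Doc. Math. 19 (2014), Lemma 20 (p. 399), Cor. 19.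
* [SerreAbelianLadic1968] J.-P. Serre, *Abelian ℓ-adic representations* (1968), IV A.1.2–A.1.3, IV-23.
* [Kato2004Asterisque] K. Kato, Astérisque 295 (2004), (12.5.2) (p. 222).
-/

noncomputable section

open scoped Classical NumberField

open WeierstrassCurve Literature.NumberTheory.EllipticCurves

namespace Literature.NumberTheory.EllipticCurves.Rank1Residual

variable {W : WeierstrassCurve ℚ} [W.IsElliptic] {p : ℕ} [Fact p.Prime]

variable (W) in
/-- **`Mult W p ∧ Surj W p ⟹ ρ̄_{E,p^n}` onto for all `n`** (`p` odd) — THEOREM, no Lemma-20 / Serre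
binder. [cite: Wuthrich2014, Lemma 20 (p. 399)] [cite: SerreAbelianLadic1968, IV A.1.2–A.1.3] -/
theorem surjective_pow_of_mult_of_surj (hp2 : p ≠ 2) (hmult : Mult W p) (hsurj : Surj W p) :
    ∀ n : ℕ, W.HasSurjectiveModNGaloisRep (p ^ n : ℕ) :=
  W.forall_hasSurjectiveModNGaloisRep_pow_of_multiplicative_of_surj p hp2 hmult hsurj

/-- **Drop-in for `Typed.surjective_pow_three_of_mult` without `h20`**: multiplicative reduction at
`3` and `ρ̄_{E,3}` onto give the whole `3`-adic tower. [cite: Wuthrich2014, Lemma 20 (p. 399)] -/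
theorem surjective_pow_three_of_mult_of_tateLine (W : WeierstrassCurve ℚ) [W.IsElliptic]
    [Fact (3 : ℕ).Prime] (hmult : W.HasMultiplicativeReductionAtPrime 3)
    (hρ : W.HasSurjectiveModNGaloisRep 3) : ∀ n : ℕ, W.HasSurjectiveModNGaloisRep (3 ^ n : ℕ) :=
  W.forall_hasSurjectiveModNGaloisRep_pow_of_multiplicative_of_surj 3 (by decide) hmult hρ

section X11

variable [W.IsGloballyMinimal]

variable (W) in
/-- **On X11 at `p = 3` with `surj(3)`, `ρ̄_{E,3^n}` is onto for every `n` — unconditionally**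
(cf. `CellThree.surjective_pow_of_surj` on the Summits side, the same statement under the named fact
`h20`). [cite: Wuthrich2014, Lemma 20 (p. 399)] -/
theorem X11.towerSurj_of_surj (hX : ClassX11 W 3) (hsurj : Surj W 3) :
    ∀ n : ℕ, W.HasSurjectiveModNGaloisRep (3 ^ n : ℕ) :=
  surjective_pow_of_mult_of_surj W (by decide) hX.1 hsurj

variable (W) in
/-- **Kato's (12.5.2) holds on X11 ∩ surj(3) at `p = 3`.**
[cite: Kato2004Asterisque, (12.5.2) in Thm. 12.5 (4) (p. 222)] [cite: Wuthrich2014, Cor. 19] -/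
theorem X11.imageContainsSL2_of_surj (hX : ClassX11 W 3) (hsurj : Surj W 3) :
    Kato2004.ImageContainsSL2 W 3 :=
  Kato2004.imageContainsSL2_of_multiplicative_of_surj W 3 (by decide) hX.1 hsurj

variable (W) in
/-- **Wuthrich's Lemma 20 off the good-supersingular locus, predicate form**: at `p = 3`,
`(GoodOrd W 3 ∨ Mult W 3) → Surj W 3 → ∀ n, surj(3^n)` — a theorem (the named fact A9 is needed
only on `GoodSS W 3`). [cite: Wuthrich2014, Lemma 20 (p. 399)] -/
theorem surjective_pow_three_of_semistable_of_not_supersingular_of_surj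
    (hred : GoodOrd W 3 ∨ Mult W 3) (hsurj : Surj W 3) :
    ∀ n : ℕ, W.HasSurjectiveModNGaloisRep (3 ^ n : ℕ) :=
  W.forall_hasSurjectiveModNGaloisRep_three_pow_of_not_additive_of_not_supersingular
    (hred.imp_left fun h ↦ ⟨h.1, h.2⟩) hsurj

end X11

end Literature.NumberTheory.EllipticCurves.Rank1Residual

end
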